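import Literature.NumberTheory.Sieve.SmoothTernaryCrudeCount
import Literature.NumberTheory.Sieve.SmoothPolylogRegimeScales
import Literature.NumberTheory.Sieve.SmoothSaddleScaleCompare
import HarnessLib

/-!
# Crude counts of friable solutions of `d₁n₁ ± d₂n₂ = n₃` in shrunken boxes, polylog regime

Topic `Literature/NumberTheory/Sieve`; a PROVED tool file.  The Hölder bound `ternary_crude_count`
(`SmoothTernaryCrudeCount.lean`, [Harper2016, Thm 2 and §5]) read at the scales met by TAIL estimates for
friable `a + b = c` with a divisibility condition on one variable: `x → ∞` a natural number,
`y = ⌊(log x)^{100000}⌋`, boxes `n_i ≤ z_i` with `√x ≤ z_i ≤ x` (so that every scale is in Harper's regime,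
`polylog_regime_at_scales`, and the saddle sizes compare with the master one by Rankin,
`saddleSize_div_le`: `𝓟(z) ≤ C (x/z)^{-α} 𝓟(x)`), dilations `d₁, d₂ ∣ (2q)^k` for an odd prime `q`, and
`d₁z₁ + d₂z₂ + z₃ ≤ x`:

* `ternary_crude_count_scales` —
  `#{solutions} ≤ C (log x)^{24} (z₁/x)^{7/12} (z₂/x)^{7/12} Ψ(x,y)³ / x`
  (the number of sample points is an odd `N₀ ∈ (x, x+4]` coprime to `q`; `(1 + N₀/z_i)^{2/5} (x/z_i)^{-α} ≤
  3 (x/z_i)^{2/5-α} ≤ 3 (z_i/x)^{7/12}` as `α ≥ 1 − 10⁻⁴`; `𝓟(x) ≤ 50 Ψ(x,y)` by Hildebrand–Tenenbaum);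
* the two-regime form with one shrunken box is `ternary_crude_count_two_regimes`
  (`SmoothTernaryCrudeCountRegimes.lean`).

## References

* A. J. Harper, *Minor arcs, mean values, and restriction theory for exponential sums over smooth
  numbers*, Compositio Math. 152 (2016) 1121–1158, Theorem 2 and §5 [Harper2016].
* A. Hildebrand, G. Tenenbaum, Trans. Amer. Math. Soc. 296 (1986) 265–290, Thm 1 [HildebrandTenenbaum1986].
-/

noncomputable section

open Finset Filter Real

namespace Literature.NumberTheory.Sieve

namespace TernaryCrudeCount

/-! ### The number of sample points: odd, coprime to `q`, in `(x, x+4]` -/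

/-- For an odd prime `q` and every `x` there is `N₀ ∈ (x, x+4]` coprime to `2q` (among two odd numbers
differing by `2`, at most one is divisible by `q`). [folklore] -/
theorem exists_oddCoprime_near (x q : ℕ) (hq : q.Prime) (hq2 : q ≠ 2) :
    ∃ N₀ : ℕ, x < N₀ ∧ N₀ ≤ x + 4 ∧ Nat.Coprime 2 N₀ ∧ Nat.Coprime q N₀ := by
  obtain ⟨n₁, hn₁x, hn₁le, hn₁odd⟩ : ∃ n₁, x < n₁ ∧ n₁ ≤ x + 2 ∧ Odd n₁ := by
    rcases Nat.even_or_odd x with hx | hx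
    · exact ⟨x + 1, by omega, by omega, hx.add_one⟩
    · exact ⟨x + 2, by omega, by omega, hx.add_even even_two⟩
  have hq3 : 3 ≤ q := by have := hq.two_le; omega
  by_cases hdvd : q ∣ n₁
  · refine ⟨n₁ + 2, by omega, by omega, Nat.coprime_two_left.2 (hn₁odd.add_even even_two), ?_⟩
    rw [Nat.Prime.coprime_iff_not_dvd hq]
    intro h2
    have h : q ∣ 2 := (Nat.dvd_add_right hdvd).1 h2
    have := Nat.le_of_dvd two_pos h
    omega
  · exact ⟨n₁, hn₁x, by omega, Nat.coprime_two_left.2 hn₁odd, (Nat.Prime.coprime_iff_not_dvd hq).2 hdvd⟩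

/-- A divisor of `(2q)^k` is coprime to every `N₀` coprime to `2` and `q`. [folklore] -/
theorem coprime_of_dvd_pow {d q N₀ k : ℕ} (h2 : Nat.Coprime 2 N₀) (hq : Nat.Coprime q N₀)
    (hd : d ∣ (2 * q) ^ k) : Nat.Coprime d N₀ :=
  Nat.Coprime.coprime_dvd_left hd (Nat.Coprime.pow_left k (Nat.coprime_mul_iff_left.2 ⟨h2, hq⟩))

/-! ### rpow bookkeeping -/

/-- `(1 + N₀/z)^e ≤ 3 (x/z)^e` for `0 ≤ N₀ ≤ 2x`, `0 < z ≤ x`, `0 ≤ e ≤ 1`. [folklore] -/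
theorem one_add_div_rpow_le {N₀ x z e : ℝ} (hz : 0 < z) (hzx : z ≤ x) (hN0 : 0 ≤ N₀) (hN : N₀ ≤ 2 * x)
    (he0 : 0 ≤ e) (he1 : e ≤ 1) : (1 + N₀ / z) ^ e ≤ 3 * (x / z) ^ e := by
  have hr1 : 1 ≤ x / z := by rw [le_div_iff₀ hz]; linarith
  have hle : 1 + N₀ / z ≤ 3 * (x / z) := by
    have : N₀ / z ≤ 2 * x / z := div_le_div_of_nonneg_right hN hz.le
    have e2 : 2 * x / z = 2 * (x / z) := by ring
    linarith
  have hpos : 0 ≤ 1 + N₀ / z := by positivity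
  calc (1 + N₀ / z) ^ e ≤ (3 * (x / z)) ^ e := Real.rpow_le_rpow hpos hle he0
    _ = 3 ^ e * (x / z) ^ e := Real.mul_rpow (by norm_num) (by linarith)
    _ ≤ 3 * (x / z) ^ e := by
        have h3 : (3 : ℝ) ^ e ≤ 3 ^ (1 : ℝ) := Real.rpow_le_rpow_of_exponent_le (by norm_num) he1
        rw [Real.rpow_one] at h3
        exact mul_le_mul_of_nonneg_right h3 (Real.rpow_nonneg (by linarith) _)

/-- `r^{2/5} · r^{-α} ≤ (r⁻¹)^{7/12}`-type bookkeeping: for `r ≥ 1` and `α ≥ 1 − 10⁻⁴`,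
`r^{2/5} r^{-α} ≤ r^{-(7/12)}`. [folklore] -/
theorem rpow_two_fifths_mul_rpow_neg_le {r α : ℝ} (hr : 1 ≤ r) (hα : 1 - 1 / 10000 ≤ α) :
    r ^ (2 / 5 : ℝ) * r ^ (-α) ≤ r ^ (-(7 / 12 : ℝ)) := by
  rw [← Real.rpow_add (by linarith)]
  exact Real.rpow_le_rpow_of_exponent_le hr (by linarith)

/-- `r^{-(7/12)} = (z/x)^{7/12}` for `r = x/z`. [folklore] -/
theorem rpow_neg_div {x z : ℝ} (hx : 0 ≤ x) (hz : 0 ≤ z) (e : ℝ) : (x / z) ^ (-e) = (z / x) ^ e := by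
  rw [Real.rpow_neg (div_nonneg hx hz), ← Real.inv_rpow (div_nonneg hx hz), inv_div]

/-- `r^{1/5} · (r^{-α})^{1/2} ≤ 1` for `r ≥ 1`, `α ≥ 1 − 10⁻⁴`. [folklore] -/
theorem rpow_fifth_mul_le_one {r α : ℝ} (hr : 1 ≤ r) (hα : 1 - 1 / 10000 ≤ α) :
    r ^ (1 / 5 : ℝ) * (r ^ (-α)) ^ (1 / 2 : ℝ) ≤ 1 := by
  rw [← Real.rpow_mul (by linarith), ← Real.rpow_add (by linarith)]
  exact Real.rpow_le_one_of_one_le_of_nonpos hr (by linarith)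

/-- `(C P)^{1/2} ≤ C' P^{1/2}` when `0 ≤ C ≤ C'` and `1 ≤ C'`, `0 ≤ P`. [folklore] -/
theorem sqrt_const_mul_le {C C' P : ℝ} (hC : 0 ≤ C) (hCC' : C ≤ C') (hC'1 : 1 ≤ C') (hP : 0 ≤ P) :
    (C * P) ^ (1 / 2 : ℝ) ≤ C' * P ^ (1 / 2 : ℝ) := by
  rw [Real.mul_rpow hC hP]
  refine mul_le_mul_of_nonneg_right ?_ (Real.rpow_nonneg hP _)
  calc C ^ (1 / 2 : ℝ) ≤ C' ^ (1 / 2 : ℝ) := Real.rpow_le_rpow hC hCC' (by norm_num)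
    _ ≤ C' ^ (1 : ℝ) := Real.rpow_le_rpow_of_exponent_le hC'1 (by norm_num)
    _ = C' := Real.rpow_one C'

/-- `P^{1/2} Ψ^{1/2} ≤ 50 Ψ` when `0 ≤ P ≤ 50 Ψ`. [folklore] -/
theorem sqrt_mul_sqrt_le {P Ψ : ℝ} (hP : 0 ≤ P) (hΨ : 0 ≤ Ψ) (h : P ≤ 50 * Ψ) :
    P ^ (1 / 2 : ℝ) * Ψ ^ (1 / 2 : ℝ) ≤ 50 * Ψ := by
  have h1 : P ^ (1 / 2 : ℝ) ≤ (50 * Ψ) ^ (1 / 2 : ℝ) := Real.rpow_le_rpow hP h (by norm_num)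
  have h2 : (50 * Ψ) ^ (1 / 2 : ℝ) = 50 ^ (1 / 2 : ℝ) * Ψ ^ (1 / 2 : ℝ) := Real.mul_rpow (by norm_num) hΨ
  have h50 : (50 : ℝ) ^ (1 / 2 : ℝ) ≤ 50 := by
    calc (50 : ℝ) ^ (1 / 2 : ℝ) ≤ 50 ^ (1 : ℝ) := Real.rpow_le_rpow_of_exponent_le (by norm_num) (by norm_num)
      _ = 50 := Real.rpow_one 50
  have hΨh : 0 ≤ Ψ ^ (1 / 2 : ℝ) := Real.rpow_nonneg hΨ _
  have hsq : Ψ ^ (1 / 2 : ℝ) * Ψ ^ (1 / 2 : ℝ) = Ψ := by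
    rw [← Real.rpow_add' hΨ (by norm_num)]; norm_num
  calc P ^ (1 / 2 : ℝ) * Ψ ^ (1 / 2 : ℝ) ≤ (50 ^ (1 / 2 : ℝ) * Ψ ^ (1 / 2 : ℝ)) * Ψ ^ (1 / 2 : ℝ) := by
        rw [← h2]; exact mul_le_mul_of_nonneg_right h1 hΨh
    _ ≤ (50 * Ψ ^ (1 / 2 : ℝ)) * Ψ ^ (1 / 2 : ℝ) :=
        mul_le_mul_of_nonneg_right (mul_le_mul_of_nonneg_right h50 hΨh) hΨh
    _ = 50 * Ψ := by rw [mul_assoc, hsq]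

end TernaryCrudeCount

open TernaryCrudeCount

/-! ### The Hölder count at the scales `z_i ∈ [√x, x]` -/

/-- **Crude Hölder count in the polylog regime, boxes in `[√x, x]`.**  For all large natural `x`, with
`y = ⌊(log x)^{100000}⌋` and `Ψ = Ψ(x, y)`: for every odd prime `q`, natural `z₁, z₂, z₃ ∈ [√x, x]`, dilations
`d₁ d₂ ∣ (2q)^k`, sign `σ = ±1` and `d₁z₁ + d₂z₂ + z₃ ≤ x`, the number of `(n₁, n₂, n₃) ∈ S(z₁,y) × S(z₂,y) × S(z₃,y)`
with `d₁n₁ + σd₂n₂ = n₃` is at most `C (log x)^{24} (z₁/x)^{7/12} (z₂/x)^{7/12} Ψ³ / x`.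
[cite: Harper2016, Theorem 2 and §5] -/
theorem ternary_crude_count_scales :
    ∃ C : ℝ, 0 < C ∧ ∀ᶠ x : ℕ in atTop, ∀ (q : ℕ), q.Prime → q ≠ 2 →
      ∀ (z₁ z₂ z₃ d₁ d₂ k : ℕ) (σ : ℤ), (σ = 1 ∨ σ = -1) → d₁ * d₂ ∣ (2 * q) ^ k →
      (x : ℝ) ^ (1 / 2 : ℝ) ≤ z₁ → (x : ℝ) ^ (1 / 2 : ℝ) ≤ z₂ → (x : ℝ) ^ (1 / 2 : ℝ) ≤ z₃ →
      z₁ ≤ x → z₂ ≤ x → z₃ ≤ x → d₁ * z₁ + d₂ * z₂ + z₃ ≤ x →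
      (#((Nat.smoothNumbersUpTo z₁ (⌊Real.log x ^ 100000⌋₊ + 1) ×ˢ
            Nat.smoothNumbersUpTo z₂ (⌊Real.log x ^ 100000⌋₊ + 1) ×ˢ
            Nat.smoothNumbersUpTo z₃ (⌊Real.log x ^ 100000⌋₊ + 1)).filter
          (fun t : ℕ × ℕ × ℕ => (d₁ * t.1 : ℤ) + σ * (d₂ * t.2.1) = t.2.2)) : ℝ) ≤
        C * Real.log x ^ 24 * ((z₁ : ℝ) / x) ^ (7 / 12 : ℝ) * ((z₂ : ℝ) / x) ^ (7 / 12 : ℝ) *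
          ((Nat.smoothNumbersUpTo x (⌊Real.log x ^ 100000⌋₊ + 1)).card : ℝ) ^ 3 / x := by
  obtain ⟨C₀, x₀, hC₀, hF⟩ := ternary_crude_count
  obtain ⟨C₁, x₁, hC₁, hP⟩ := saddleSize_div_le
  obtain ⟨x₂, hΨ⟩ := card_smoothNumbersUpTo_two_sided
  set C₁' : ℝ := max C₁ 1 with hC₁'
  have hC₁'1 : 1 ≤ C₁' := le_max_right _ _
  have hC₁'0 : 0 < C₁' := by linarith
  have hC₁le : C₁ ≤ C₁' := le_max_left _ _
  refine ⟨C₀ * 3375000 * C₁' ^ 3, by positivity, ?_⟩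
  have T : Tendsto (fun x : ℕ => (x : ℝ)) atTop atTop := tendsto_natCast_atTop_atTop
  filter_upwards [T.eventually (polylog_regime_at_scales x₀), T.eventually polylog_regime_basic,
    T.eventually (eventually_ge_atTop (max x₁ x₂)), T.eventually (eventually_ge_atTop (4 : ℝ))]
    with x hsc hb hx12 hx4 q hq hq2 z₁ z₂ z₃ d₁ d₂ k σ hσ hdk hz₁ hz₂ hz₃ hz₁x hz₂x hz₃x hwrap
  obtain ⟨hx1, -, hy2, -, -, hy4, -, -, hlogy5, -, hsqrtx⟩ := hb
  have hxx₁ : x₁ ≤ (x : ℝ) := le_trans (le_max_left _ _) hx12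
  have hxx₂ : x₂ ≤ (x : ℝ) := le_trans (le_max_right _ _) hx12
  set y : ℕ := ⌊Real.log (x : ℝ) ^ 100000⌋₊ with hy
  have hX0 : (0 : ℝ) < x := by linarith
  -- the regime at the four scales
  have hz₁x' : (z₁ : ℝ) ≤ x := by exact_mod_cast hz₁x
  have hz₂x' : (z₂ : ℝ) ≤ x := by exact_mod_cast hz₂x
  have hz₃x' : (z₃ : ℝ) ≤ x := by exact_mod_cast hz₃x
  obtain ⟨a₁, b₁, c₁, e₁, f₁, g₁⟩ := hsc z₁ hz₁ hz₁x'
  obtain ⟨a₂, b₂, c₂, e₂, f₂, g₂⟩ := hsc z₂ hz₂ hz₂x'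
  obtain ⟨a₃, b₃, c₃, e₃, f₃, g₃⟩ := hsc z₃ hz₃ hz₃x'
  obtain ⟨-, -, -, -, fₓ, gₓ⟩ := hsc x hsqrtx le_rfl
  clear hsc
  rw [Nat.floor_natCast] at gₓ
  -- the sample points
  obtain ⟨N₀, hN₀x, hN₀le, h2N, hqN⟩ := exists_oddCoprime_near x q hq hq2
  have hd₁ : Nat.Coprime d₁ N₀ := coprime_of_dvd_pow h2N hqN ((dvd_mul_right d₁ d₂).trans hdk)
  have hd₂ : Nat.Coprime d₂ N₀ := coprime_of_dvd_pow h2N hqN ((dvd_mul_left d₂ d₁).trans hdk)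
  have hwrap' : d₁ * ⌊((z₁ : ℕ) : ℝ)⌋₊ + d₂ * ⌊((z₂ : ℕ) : ℝ)⌋₊ + ⌊((z₃ : ℕ) : ℝ)⌋₊ < N₀ := by
    simp only [Nat.floor_natCast]; omega
  have hcnt := hF y z₁ z₂ z₃ a₁ b₁ c₁ e₁ f₁ g₁ a₂ b₂ c₂ e₂ f₂ g₂ a₃ b₃ c₃ e₃ f₃ g₃ N₀ d₁ d₂ hd₁ hd₂ σ hσ hwrap'
  clear hF
  simp only [Nat.floor_natCast] at hcnt g₃
  -- names for the master saddle size and `Ψ(x, y)`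
  set α : ℝ := saddlePoint (x : ℝ) y with hα
  set Px : ℝ := (x : ℝ) ^ α * (smoothZeta α y / Real.sqrt (saddlePhi₂ α y)) with hPx
  set Ψx : ℝ := ((Nat.smoothNumbersUpTo x (y + 1)).card : ℝ) with hΨx
  have hPx0 : 0 < Px := TernaryHolder.profile_pos hx1 fₓ
  have hPxΨ : Px ≤ 50 * Ψx := by
    have h := (hΨ x y hxx₂ hy4 hlogy5).1
    rw [Nat.floor_natCast, mul_div_assoc] at h
    rw [hΨx]
    linarith
  clear hΨ
  have hΨx0 : 0 ≤ Ψx := Nat.cast_nonneg _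
  have hz1' : ∀ {z : ℕ}, (x : ℝ) ^ (1 / 2 : ℝ) ≤ z → (1 : ℝ) < z := fun hz =>
    lt_of_lt_of_le (Real.one_lt_rpow hx1 (by norm_num)) hz
  -- Rankin comparison of the saddle size at `z` with the master one, and positivity
  have hcmp : ∀ z : ℕ, (x : ℝ) ^ (1 / 2 : ℝ) ≤ z → (z : ℝ) ≤ x → 1 - 1 / 10000 ≤ saddlePoint (z : ℝ) y →
      (z : ℝ) ^ saddlePoint (z : ℝ) y * (smoothZeta (saddlePoint (z : ℝ) y) y /
          Real.sqrt (saddlePhi₂ (saddlePoint (z : ℝ) y) y)) ≤ C₁ * ((x : ℝ) / z) ^ (-α) * Px ∧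
        1 ≤ (x : ℝ) / z ∧ 0 < (z : ℝ) ∧
        0 < (z : ℝ) ^ saddlePoint (z : ℝ) y * (smoothZeta (saddlePoint (z : ℝ) y) y /
          Real.sqrt (saddlePhi₂ (saddlePoint (z : ℝ) y) y)) := by
    intro z hz hzx hαz
    have hz0 : (0 : ℝ) < z := lt_of_lt_of_le (Real.rpow_pos_of_pos hX0 _) hz
    have hg1 : 1 ≤ (x : ℝ) / z := by rw [le_div_iff₀ hz0]; linarith
    have hg2 : (x : ℝ) / z ≤ (x : ℝ) ^ (1 / 2 : ℝ) := by
      rw [div_le_iff₀ hz0]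
      calc (x : ℝ) = (x : ℝ) ^ (1 / 2 : ℝ) * (x : ℝ) ^ (1 / 2 : ℝ) := by
            rw [← Real.rpow_add hX0]; norm_num
        _ ≤ (x : ℝ) ^ (1 / 2 : ℝ) * z := mul_le_mul_of_nonneg_left hz (Real.rpow_nonneg hX0.le _)
    have h := hP x y hxx₁ hy4 hlogy5 ((x : ℝ) / z) hg1 hg2
    have hg : (x : ℝ) / ((x : ℝ) / z) = z := by field_simp
    rw [hg, mul_div_assoc, mul_div_assoc] at h
    exact ⟨h, hg1, hz0, TernaryHolder.profile_pos (hz1' hz) hαz⟩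
  obtain ⟨hP₁, hr₁, hz₁0, hP₁0⟩ := hcmp z₁ hz₁ hz₁x' f₁
  obtain ⟨hP₂, hr₂, hz₂0, hP₂0⟩ := hcmp z₂ hz₂ hz₂x' f₂
  obtain ⟨hP₃, hr₃, hz₃0, hP₃0⟩ := hcmp z₃ hz₃ hz₃x' f₃
  clear hcmp hP
  -- `N₀ ≤ 2x`
  have hN₀2 : (N₀ : ℝ) ≤ 2 * x := by
    have : (N₀ : ℝ) ≤ x + 4 := by exact_mod_cast hN₀le
    linarith
  have hN₀0 : (0 : ℝ) ≤ N₀ := Nat.cast_nonneg _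
  -- factor 1: the logarithms
  set L : ℝ := Real.log (x : ℝ) with hL
  have hL0 : 0 ≤ L := Real.log_nonneg hx1.le
  have hlogz : ∀ {z : ℕ}, (x : ℝ) ^ (1 / 2 : ℝ) ≤ z → (z : ℝ) ≤ x → 0 ≤ Real.log z ∧ Real.log z ≤ L :=
    fun hz hzx => ⟨Real.log_nonneg (hz1' hz).le, Real.log_le_log (by linarith [hz1' hz]) hzx⟩
  have hA : (Real.log z₁ * Real.log z₂ * Real.log z₃) ^ (8 : ℕ) ≤ L ^ 24 := by
    obtain ⟨l10, l1L⟩ := hlogz hz₁ hz₁x'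
    obtain ⟨l20, l2L⟩ := hlogz hz₂ hz₂x'
    obtain ⟨l30, l3L⟩ := hlogz hz₃ hz₃x'
    calc (Real.log z₁ * Real.log z₂ * Real.log z₃) ^ (8 : ℕ) ≤ (L * L * L) ^ (8 : ℕ) :=
          pow_le_pow_left₀ (by positivity) (mul_le_mul (mul_le_mul l1L l2L l20 hL0) l3L l30 (by positivity)) 8
      _ = L ^ 24 := by ring
  -- factors 2 and 3: `(1 + N₀/z_i)^{2/5} P_i ≤ 150 C₁' (z_i/x)^{7/12} Ψx`
  have hB : ∀ {z : ℕ} {P : ℝ}, (z : ℝ) ≤ x → 0 < (z : ℝ) → 1 ≤ (x : ℝ) / z → 0 ≤ P →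
      P ≤ C₁ * ((x : ℝ) / z) ^ (-α) * Px →
      (1 + (N₀ : ℝ) / z) ^ (2 / 5 : ℝ) * P ≤ 150 * C₁' * ((z : ℝ) / x) ^ (7 / 12 : ℝ) * Ψx := by
    intro z P hzx hz0 hr hP0 hPz
    have hO := one_add_div_rpow_le (e := 2 / 5) hz0 hzx hN₀0 hN₀2 (by norm_num) (by norm_num)
    have hr0 : 0 ≤ ((x : ℝ) / z) ^ (-α) := Real.rpow_nonneg (by positivity) _
    have hkey : ((x : ℝ) / z) ^ (2 / 5 : ℝ) * ((x : ℝ) / z) ^ (-α) ≤ ((z : ℝ) / x) ^ (7 / 12 : ℝ) := by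
      rw [← rpow_neg_div hX0.le hz0.le]
      exact rpow_two_fifths_mul_rpow_neg_le hr fₓ
    have h25 : 0 ≤ ((x : ℝ) / z) ^ (2 / 5 : ℝ) := Real.rpow_nonneg (by positivity) _
    calc (1 + (N₀ : ℝ) / z) ^ (2 / 5 : ℝ) * P
        ≤ (3 * ((x : ℝ) / z) ^ (2 / 5 : ℝ)) * (C₁ * ((x : ℝ) / z) ^ (-α) * Px) :=
          mul_le_mul hO hPz hP0 (by positivity)
      _ = 3 * C₁ * (((x : ℝ) / z) ^ (2 / 5 : ℝ) * ((x : ℝ) / z) ^ (-α)) * Px := by ring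
      _ ≤ 3 * C₁' * ((z : ℝ) / x) ^ (7 / 12 : ℝ) * (50 * Ψx) := by
          have h1 : 3 * C₁ * (((x : ℝ) / z) ^ (2 / 5 : ℝ) * ((x : ℝ) / z) ^ (-α)) ≤
              3 * C₁' * ((z : ℝ) / x) ^ (7 / 12 : ℝ) :=
            mul_le_mul (by linarith) hkey (mul_nonneg h25 hr0) (by positivity)
          exact mul_le_mul h1 hPxΨ hPx0.le (by positivity)
      _ = 150 * C₁' * ((z : ℝ) / x) ^ (7 / 12 : ℝ) * Ψx := by ring
  have hB₁ := hB hz₁x' hz₁0 hr₁ hP₁0.le hP₁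
  have hB₂ := hB hz₂x' hz₂0 hr₂ hP₂0.le hP₂
  -- factor 4: `(1 + N₀/z₃)^{1/5} P₃^{1/2} Ψ(z₃)^{1/2} ≤ 150 C₁' Ψx`
  have hΨ₃ : ((Nat.smoothNumbersUpTo z₃ (y + 1)).card : ℝ) ≤ Ψx := by
    rw [hΨx]
    exact_mod_cast Finset.card_le_card (Endgame.smoothNumbersUpTo_mono_left hz₃x (y + 1))
  have hB' : ∀ {z : ℕ} {P Ψ₃ : ℝ}, (z : ℝ) ≤ x → 0 < (z : ℝ) → 1 ≤ (x : ℝ) / z → 0 < P →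
      P ≤ C₁ * ((x : ℝ) / z) ^ (-α) * Px → 0 ≤ Ψ₃ → Ψ₃ ≤ Ψx →
      (1 + (N₀ : ℝ) / z) ^ (1 / 5 : ℝ) * P ^ (1 / 2 : ℝ) * Ψ₃ ^ (1 / 2 : ℝ) ≤ 150 * C₁' * Ψx := by
    intro z P Ψ₃ hzx hz0 hr hP0 hPz hΨ₃0 hΨ₃
    have hO := one_add_div_rpow_le (e := 1 / 5) hz0 hzx hN₀0 hN₀2 (by norm_num) (by norm_num)
    have hr0 : 0 ≤ ((x : ℝ) / z) ^ (-α) := Real.rpow_nonneg (by positivity) _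
    have hsq : P ^ (1 / 2 : ℝ) ≤ C₁' * (((x : ℝ) / z) ^ (-α)) ^ (1 / 2 : ℝ) * Px ^ (1 / 2 : ℝ) := by
      have h1 : P ^ (1 / 2 : ℝ) ≤ (C₁ * ((x : ℝ) / z) ^ (-α) * Px) ^ (1 / 2 : ℝ) :=
        Real.rpow_le_rpow hP0.le hPz (by norm_num)
      calc P ^ (1 / 2 : ℝ) ≤ (C₁ * (((x : ℝ) / z) ^ (-α) * Px)) ^ (1 / 2 : ℝ) := by rw [← mul_assoc]; exact h1
        _ ≤ C₁' * (((x : ℝ) / z) ^ (-α) * Px) ^ (1 / 2 : ℝ) :=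
            sqrt_const_mul_le hC₁.le hC₁le hC₁'1 (mul_nonneg hr0 hPx0.le)
        _ = C₁' * (((x : ℝ) / z) ^ (-α)) ^ (1 / 2 : ℝ) * Px ^ (1 / 2 : ℝ) := by
            rw [Real.mul_rpow hr0 hPx0.le]; ring
    have hone : ((x : ℝ) / z) ^ (1 / 5 : ℝ) * (((x : ℝ) / z) ^ (-α)) ^ (1 / 2 : ℝ) ≤ 1 :=
      rpow_fifth_mul_le_one hr fₓ
    have hPΨ : Px ^ (1 / 2 : ℝ) * Ψ₃ ^ (1 / 2 : ℝ) ≤ 50 * Ψx := by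
      have h1 : Ψ₃ ^ (1 / 2 : ℝ) ≤ Ψx ^ (1 / 2 : ℝ) := Real.rpow_le_rpow hΨ₃0 hΨ₃ (by norm_num)
      calc Px ^ (1 / 2 : ℝ) * Ψ₃ ^ (1 / 2 : ℝ) ≤ Px ^ (1 / 2 : ℝ) * Ψx ^ (1 / 2 : ℝ) :=
            mul_le_mul_of_nonneg_left h1 (Real.rpow_nonneg hPx0.le _)
        _ ≤ 50 * Ψx := sqrt_mul_sqrt_le hPx0.le hΨx0 hPxΨ
    have h15 : 0 ≤ ((x : ℝ) / z) ^ (1 / 5 : ℝ) := Real.rpow_nonneg (by positivity) _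
    have hPxh : 0 ≤ Px ^ (1 / 2 : ℝ) := Real.rpow_nonneg hPx0.le _
    have hΨ3h : 0 ≤ Ψ₃ ^ (1 / 2 : ℝ) := Real.rpow_nonneg hΨ₃0 _
    calc (1 + (N₀ : ℝ) / z) ^ (1 / 5 : ℝ) * P ^ (1 / 2 : ℝ) * Ψ₃ ^ (1 / 2 : ℝ)
        ≤ (3 * ((x : ℝ) / z) ^ (1 / 5 : ℝ)) * (C₁' * (((x : ℝ) / z) ^ (-α)) ^ (1 / 2 : ℝ) * Px ^ (1 / 2 : ℝ)) *
            Ψ₃ ^ (1 / 2 : ℝ) :=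
          mul_le_mul_of_nonneg_right (mul_le_mul hO hsq (Real.rpow_nonneg hP0.le _) (by positivity)) hΨ3h
      _ = 3 * C₁' * (((x : ℝ) / z) ^ (1 / 5 : ℝ) * (((x : ℝ) / z) ^ (-α)) ^ (1 / 2 : ℝ)) *
            (Px ^ (1 / 2 : ℝ) * Ψ₃ ^ (1 / 2 : ℝ)) := by ring
      _ ≤ 3 * C₁' * 1 * (50 * Ψx) :=
          mul_le_mul (mul_le_mul_of_nonneg_left hone (by positivity)) hPΨ (mul_nonneg hPxh hΨ3h)
            (by positivity)
      _ = 150 * C₁' * Ψx := by ring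
  have hB₃ := hB' hz₃x' hz₃0 hr₃ hP₃0 hP₃ (Nat.cast_nonneg _) hΨ₃
  -- factor 5: `1/N₀ ≤ 1/x`
  have hN₀inv : (1 : ℝ) / N₀ ≤ 1 / x :=
    one_div_le_one_div_of_le hX0 (by exact_mod_cast hN₀x.le)
  -- assembly: regroup the Hölder bound and bound factor by factor
  have key : ∀ {c A O₁ Q₁ O₂ Q₂ O₃ Q₃ W n : ℝ},
      c ≤ C₀ * A * O₁ * O₂ * O₃ * Q₁ * Q₂ * Q₃ * W / n →
        c ≤ C₀ * A * (O₁ * Q₁) * (O₂ * Q₂) * (O₃ * Q₃ * W) * (1 / n) := by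
    intro c A O₁ Q₁ O₂ Q₂ O₃ Q₃ W n h
    calc c ≤ _ := h
      _ = _ := by ring
  have h2 := key hcnt
  clear key hcnt
  clear_value Ψx Px α L y
  have hr₁0 : 0 ≤ ((z₁ : ℝ) / x) ^ (7 / 12 : ℝ) := Real.rpow_nonneg (by positivity) _
  have hr₂0 : 0 ≤ ((z₂ : ℝ) / x) ^ (7 / 12 : ℝ) := Real.rpow_nonneg (by positivity) _
  have hK0 : (0 : ℝ) ≤ 150 * C₁' := by positivity
  have hb1 : 0 ≤ 150 * C₁' * ((z₁ : ℝ) / x) ^ (7 / 12 : ℝ) * Ψx := mul_nonneg (mul_nonneg hK0 hr₁0) hΨx0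
  have hb2 : 0 ≤ 150 * C₁' * ((z₂ : ℝ) / x) ^ (7 / 12 : ℝ) * Ψx := mul_nonneg (mul_nonneg hK0 hr₂0) hΨx0
  have hb3 : 0 ≤ 150 * C₁' * Ψx := mul_nonneg hK0 hΨx0
  have hL24 : 0 ≤ L ^ 24 := pow_nonneg hL0 24
  have hCL : 0 ≤ C₀ * L ^ 24 := mul_nonneg hC₀.le hL24
  have hO₁0 : 0 ≤ (1 + (N₀ : ℝ) / z₁) ^ (2 / 5 : ℝ) := Real.rpow_nonneg (by positivity) _
  have hO₂0 : 0 ≤ (1 + (N₀ : ℝ) / z₂) ^ (2 / 5 : ℝ) := Real.rpow_nonneg (by positivity) _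
  have hO₃0 : 0 ≤ (1 + (N₀ : ℝ) / z₃) ^ (1 / 5 : ℝ) := Real.rpow_nonneg (by positivity) _
  have hP₃h0 := Real.rpow_nonneg hP₃0.le (1 / 2 : ℝ)
  have hΨ3h0 : 0 ≤ ((Nat.smoothNumbersUpTo z₃ (y + 1)).card : ℝ) ^ (1 / 2 : ℝ) :=
    Real.rpow_nonneg (Nat.cast_nonneg _) _
  have hxinv : (0 : ℝ) ≤ 1 / x := by positivity
  calc _ ≤ _ := h2
    _ ≤ C₀ * L ^ 24 * (150 * C₁' * ((z₁ : ℝ) / x) ^ (7 / 12 : ℝ) * Ψx) *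
          (150 * C₁' * ((z₂ : ℝ) / x) ^ (7 / 12 : ℝ) * Ψx) * (150 * C₁' * Ψx) * (1 / x) := by
        refine mul_le_mul ?_ hN₀inv (by positivity) (mul_nonneg (mul_nonneg (mul_nonneg hCL hb1) hb2) hb3)
        refine mul_le_mul ?_ hB₃ (mul_nonneg (mul_nonneg hO₃0 hP₃h0) hΨ3h0)
          (mul_nonneg (mul_nonneg hCL hb1) hb2)
        refine mul_le_mul ?_ hB₂ (mul_nonneg hO₂0 hP₂0.le) (mul_nonneg hCL hb1)
        refine mul_le_mul ?_ hB₁ (mul_nonneg hO₁0 hP₁0.le) hCL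
        exact mul_le_mul_of_nonneg_left hA hC₀.le
    _ = C₀ * 3375000 * C₁' ^ 3 * L ^ 24 * ((z₁ : ℝ) / x) ^ (7 / 12 : ℝ) * ((z₂ : ℝ) / x) ^ (7 / 12 : ℝ) *
          Ψx ^ 3 / x := by ring

end Literature.NumberTheory.Sieve

end
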